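import Literature.AlgebraicGeometry.Frobenioids.Composites
import Literature.AlgebraicGeometry.Frobenioids.ElementaryIsomorphisms
import Literature.AlgebraicGeometry.Frobenioids.CategoryTheoreticityFacts
import HarnessLib

/-!
# Frobenioids I, §3: proofs of the category-theoreticity facts — Propositions 3.3 (ii), 3.11 (i)

Mochizuki, *The geometry of Frobenioids I: the general theory*, Kyushu J. Math. **62** (2008),
Prop. 3.3 "Base-identity Pre-steps and Units", (ii), statement kurims p. 59, proof p. 61
[cite: MochizukiFrdI2008, Prop. 3.3 (ii) p.59]: two co-objective morphisms `α₁, α₂ : A → B` of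
`C^istr` are unit-equivalent iff they map to the same morphism of `F_Φ`, i.e. iff
`deg_Fr(α₁) = deg_Fr(α₂)`, `Div(α₁) = Div(α₂)`, `Base(α₁) = Base(α₂)`.

PROOF-ONLY companion of `CategoryTheoreticityFacts.lean` / `BaseCategoryTheoreticityDefs.lean` (seat
abc-iut-L1-t3; statements untouched): discharges the named facts `FrdI.Prop33ii` (as
`FrdI.Prop33ii_holds`) and `FrdI.Prop311i` (Prop. 3.11 (i), `C → F_Φ` is an equivalence for Frobenioids
of isotropic, unit-trivial, group-like type over `Φ = 0`, in the unfolded form of the statement file, as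
`FrdI.Prop311i_holds`: faithfulness from the same core with trivial units, fullness from Def. 1.3
(ii), (i)(b), (i)(c), essential surjectivity from Def. 1.3 (i)(a)). The core (`FrdI.exists_unit_of_invariants_eq`, stated over found's Def. 1.1–1.3
vocabulary for any isotropic domain) follows the printed proof: factor both arrows as pull-back ∘
pre-step ∘ Frobenius-type (Def. 1.3 (iv)(a)); identify the Frobenius-type parts (Def. 1.3 (ii)); align
the pull-back parts by a lift through the pull-back property (the lift is a pre-step, Prop. 1.7 (v));
co-angularity of the middle pre-steps from Prop. 1.4 (i) and Def. 1.3 (vii)(b); compare zero divisors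
via Rem. 1.1.1 and LB-invertibility; conclude with Def. 1.3 (vi). Necessity is the Rem. 1.1.1
computation. No statement of the paper is restated or strengthened.
-/

-- `u.hom` for `u : Aut Y` and compositions across `(F ⋙ G).obj` only unfold at default transparency.
set_option backward.isDefEq.respectTransparency false

namespace Literature.AlgebraicGeometry.Frobenioids

open CategoryTheory Opposite

universe w v v' u u'

namespace FrdI

/-! ### Proposition 3.3 (ii): unit-equivalence -/

section OneFrobenioid

variable {D : Type u} [Category.{v} D] {Φ : Dᵒᵖ ⥤ CommMonCat.{w}} {C : Type u'} [Category.{v'} C]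
  {F : C ⥤ ElemFrobenioid Φ}

/-- **Prop. 3.3 (ii), sufficiency — the core** (FrdI p. 61): in a Frobenioid, two co-objective arrows
`α₁, α₂ : A → B` out of an isotropic object with the same Frobenius degree, zero divisor and base
projection differ by a unit: `α₁ = γ ≫ δ`, `α₂ = γ ≫ u ≫ δ` with `u ∈ O^×`. Proof as printed: factor
both as pull-back ∘ pre-step ∘ Frobenius-type (Def. 1.3 (iv)(a)), identify the Frobenius-type parts
(Def. 1.3 (ii)), move the pull-back parts together (pull-back property), compare divisors
(Rem. 1.1.1, LB-invertibility) and apply Def. 1.3 (vi). [cite: MochizukiFrdI2008, Prop. 3.3 (ii) p.61] -/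
theorem exists_unit_of_invariants_eq (hF : PreFrobenioid.IsFrobenioid F) {A B : C}
    (hA : PreFrobenioid.IsIsotropic F A) (α₁ α₂ : A ⟶ B)
    (hdeg : PreFrobenioid.degFr F α₁ = PreFrobenioid.degFr F α₂)
    (hdiv : PreFrobenioid.Div F α₁ = PreFrobenioid.Div F α₂)
    (hbase : PreFrobenioid.Base F α₁ = PreFrobenioid.Base F α₂) :
    ∃ (Y : C) (γ : A ⟶ Y) (δ : Y ⟶ B) (u : Aut Y),
      u ∈ PreFrobenioid.unitsSubgroup F Y ∧ α₁ = γ ≫ δ ∧ α₂ = γ ≫ u.hom ≫ δ := by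
  have hD := hF.isPreFrobenioid.isTotallyEpimorphic_base
  obtain ⟨X₁, Y₁, γ₁, β₁, δ₁, hf₁, hγ₁, hβ₁, hδ₁⟩ := hF.iv_a_exists α₁
  obtain ⟨X₂, Y₂, γ₂, β₂, δ₂, hf₂, hγ₂, hβ₂, hδ₂⟩ := hF.iv_a_exists α₂
  have hδ₁' := hF.iv_b δ₁ hδ₁   -- LB-invertible ∧ linear
  have hδ₂' := hF.iv_b δ₂ hδ₂
  -- Frobenius degrees: `deg α_i = deg γ_i`
  have hdγ : PreFrobenioid.degFr F γ₁ = PreFrobenioid.degFr F γ₂ := by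
    have e₁ : PreFrobenioid.degFr F α₁ = PreFrobenioid.degFr F γ₁ := by
      rw [← hf₁, PreFrobenioid.degFr_comp, PreFrobenioid.degFr_comp,
        show PreFrobenioid.degFr F β₁ = 1 from hβ₁.1, show PreFrobenioid.degFr F δ₁ = 1 from hδ₁'.2,
        mul_one, mul_one]
    have e₂ : PreFrobenioid.degFr F α₂ = PreFrobenioid.degFr F γ₂ := by
      rw [← hf₂, PreFrobenioid.degFr_comp, PreFrobenioid.degFr_comp,
        show PreFrobenioid.degFr F β₂ = 1 from hβ₂.1, show PreFrobenioid.degFr F δ₂ = 1 from hδ₂'.2,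
        mul_one, mul_one]
    rw [← e₁, ← e₂, hdeg]
  -- identify the Frobenius-type parts
  obtain ⟨ε, hε⟩ := hF.ii_unique γ₁ γ₂ hγ₁ hγ₂ hdγ
  set β₂' : X₁ ⟶ Y₂ := ε.hom ≫ β₂ with hβ₂'def
  have hβ₂'p : PreFrobenioid.IsPreStep F β₂' :=
    PreFrobenioid.IsPreStep.comp F (PreFrobenioid.isPreStep_of_isIso F ε.hom) hβ₂
  have hf₂' : γ₁ ≫ β₂' ≫ δ₂ = α₂ := by
    rw [hβ₂'def, Category.assoc, ← Category.assoc γ₁, hε, hf₂]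
  -- isotropy propagates: `X₁`, `Y₁` and every codomain out of `X₁` are isotropic
  have hX₁ : PreFrobenioid.IsIsotropic F X₁ := hF.vii_b γ₁ hA
  have hcoa : ∀ {Z : C} (f : X₁ ⟶ Z), PreFrobenioid.IsCoAngular F f := fun f =>
    PreFrobenioid.isCoAngular_of_isIsotropic_codomains F f (fun Z g => hF.vii_b g hX₁)
  -- base projections: `Base β₁ ≫ Base δ₁ = Base β₂' ≫ Base δ₂`
  haveI : IsIso (PreFrobenioid.Base F γ₁) := hγ₁.2
  haveI : IsIso (PreFrobenioid.Base F β₁) := hβ₁.2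
  haveI : IsIso (PreFrobenioid.Base F β₂') := hβ₂'p.2
  have hbb : PreFrobenioid.Base F β₁ ≫ PreFrobenioid.Base F δ₁ =
      PreFrobenioid.Base F β₂' ≫ PreFrobenioid.Base F δ₂ := by
    have e₁ : PreFrobenioid.Base F α₁ =
        PreFrobenioid.Base F γ₁ ≫ PreFrobenioid.Base F β₁ ≫ PreFrobenioid.Base F δ₁ := by
      rw [← hf₁, PreFrobenioid.base_comp, PreFrobenioid.base_comp]
    have e₂ : PreFrobenioid.Base F α₂ =
        PreFrobenioid.Base F γ₁ ≫ PreFrobenioid.Base F β₂' ≫ PreFrobenioid.Base F δ₂ := by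
      rw [← hf₂', PreFrobenioid.base_comp, PreFrobenioid.base_comp]
    rw [← cancel_epi (PreFrobenioid.Base F γ₁), ← e₁, ← e₂, hbase]
  -- move `δ₂` over `δ₁`: lift `(Base β₂')⁻¹ ≫ Base β₁` along the pull-back morphism `δ₁`
  have hcond : PreFrobenioid.Base F δ₂ =
      (inv (PreFrobenioid.Base F β₂') ≫ PreFrobenioid.Base F β₁) ≫ PreFrobenioid.Base F δ₁ := by
    rw [Category.assoc, hbb, IsIso.inv_hom_id_assoc]
  obtain ⟨θ, hθ⟩ := (hδ₁ Y₂).2 ⟨(δ₂, inv (PreFrobenioid.Base F β₂') ≫ PreFrobenioid.Base F β₁), hcond⟩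
  have hθ₁ : θ ≫ δ₁ = δ₂ := congrArg (fun q => q.1.1) hθ
  have hθ₂ : PreFrobenioid.Base F θ = inv (PreFrobenioid.Base F β₂') ≫ PreFrobenioid.Base F β₁ :=
    congrArg (fun q => q.1.2) hθ
  have hθp : PreFrobenioid.IsPreStep F θ := by
    refine ⟨(PreFrobenioid.isLinear_factors F (show PreFrobenioid.IsLinear F (θ ≫ δ₁) by
      rw [hθ₁]; exact hδ₂'.2)).2, ?_⟩
    change IsIso (PreFrobenioid.Base F θ)
    rw [hθ₂]
    infer_instance
  set β₂'' : X₁ ⟶ Y₁ := β₂' ≫ θ with hβ₂''def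
  have hβ₂''p : PreFrobenioid.IsPreStep F β₂'' := PreFrobenioid.IsPreStep.comp F hβ₂'p hθp
  have hf₂'' : γ₁ ≫ β₂'' ≫ δ₁ = α₂ := by
    rw [hβ₂''def, Category.assoc, hθ₁, hf₂']
  have hbase' : PreFrobenioid.BaseEquivalent F β₂'' β₁ := by
    change PreFrobenioid.Base F β₂'' = PreFrobenioid.Base F β₁
    rw [hβ₂''def, PreFrobenioid.base_comp, hθ₂, IsIso.hom_inv_id_assoc]
  -- zero divisors: `Div β₂'' = Div β₁`
  have hdivβ : ∀ {Y : C} (β : X₁ ⟶ Y) (δ : Y ⟶ B), PreFrobenioid.IsPreStep F β →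
      PreFrobenioid.IsPullbackMorphism F δ → γ₁ ≫ β ≫ δ = α₂ ∨ γ₁ ≫ β ≫ δ = α₁ →
      pull Φ (PreFrobenioid.Base F γ₁) (PreFrobenioid.Div F β) = PreFrobenioid.Div F α₁ := by
    intro Y β δ hβ hδ hf
    have hδ' := hF.iv_b δ hδ
    have e : PreFrobenioid.Div F (γ₁ ≫ β ≫ δ) =
        pull Φ (PreFrobenioid.Base F γ₁) (PreFrobenioid.Div F β) := by
      rw [PreFrobenioid.div_comp, PreFrobenioid.div_comp,
        show PreFrobenioid.Div F δ = 1 from hδ'.1.2, map_one, one_mul,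
        show PreFrobenioid.degFr F δ = 1 from hδ'.2, PNat.one_coe, pow_one,
        show PreFrobenioid.Div F γ₁ = 1 from hγ₁.1.2, one_pow, mul_one]
    rcases hf with hf | hf
    · rw [← e, hf, hdiv]
    · rw [← e, hf]
  have hdiv' : PreFrobenioid.MetricallyEquivalent F β₂'' β₁ := by
    change PreFrobenioid.Div F β₂'' = PreFrobenioid.Div F β₁
    apply pull_injective_of_isIso Φ (PreFrobenioid.Base F γ₁)
    rw [hdivβ β₂'' δ₁ hβ₂''p hδ₁ (Or.inl hf₂''), hdivβ β₁ δ₁ hβ₁ hδ₁ (Or.inr hf₁)]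
  -- Def. 1.3 (vi)
  obtain ⟨u, hu, hu'⟩ := hF.vi β₂'' β₁ ⟨hcoa β₂'', hβ₂''p⟩ ⟨hcoa β₁, hβ₁⟩ hbase' hdiv'
  refine ⟨Y₁, γ₁ ≫ β₁, δ₁, u, hu, ?_, ?_⟩
  · rw [Category.assoc, hf₁]
  · rw [Category.assoc, ← Category.assoc β₁, hu', hf₂'']

/-- **Prop. 3.3 (ii), necessity — the computation** (FrdI p. 61: "the necessity of the three conditions
(a), (b), (c) follows immediately [cf. Remark 1.1.1] from the fact that endomorphisms of `O^×` are
LB-invertible base-identity linear endomorphisms"). [cite: MochizukiFrdI2008, Prop. 3.3 (ii) p.61] -/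
theorem invariants_eq_of_unit (hP : IsPreFrobenioid Φ F) {A Y B : C} (γ : A ⟶ Y)
    (δ : Y ⟶ B) (u : Y ≅ Y)
    (hu : PreFrobenioid.IsBaseIdentity F u.hom ∧ PreFrobenioid.IsLinear F u.hom) :
    PreFrobenioid.degFr F (γ ≫ δ) = PreFrobenioid.degFr F (γ ≫ u.hom ≫ δ) ∧
      PreFrobenioid.Div F (γ ≫ δ) = PreFrobenioid.Div F (γ ≫ u.hom ≫ δ) ∧
      PreFrobenioid.Base F (γ ≫ δ) = PreFrobenioid.Base F (γ ≫ u.hom ≫ δ) := by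
  have hub : PreFrobenioid.Base F u.hom = 𝟙 _ := hu.1
  have hud : PreFrobenioid.degFr F u.hom = 1 := hu.2
  have hui : PreFrobenioid.Div F u.hom = 1 := PreFrobenioid.isIsometry_of_isIso F hP u.hom
  refine ⟨?_, ?_, ?_⟩
  · rw [PreFrobenioid.degFr_comp F γ (u.hom ≫ δ), PreFrobenioid.degFr_comp F u.hom δ, hud, one_mul,
      PreFrobenioid.degFr_comp F γ δ]
  · rw [PreFrobenioid.div_comp F γ (u.hom ≫ δ), PreFrobenioid.div_comp F u.hom δ,
      PreFrobenioid.degFr_comp F u.hom δ, hub, pull_id, hui, one_pow, mul_one, hud, one_mul,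
      PreFrobenioid.div_comp F γ δ]
  · rw [PreFrobenioid.base_comp F γ (u.hom ≫ δ), PreFrobenioid.base_comp F u.hom δ, hub,
      Category.id_comp, PreFrobenioid.base_comp F γ δ]

/-- Def. 1.3 (i)(c), essential surjectivity, unpacked: every arrow `X₀ → Base(B)` of `D` is, up to an
isomorphism of `D`, the projection of a pull-back morphism into `B` (the form used in the proofs of
Prop. 3.3 (v) / 3.11 (i); `TODO-merge: abc-iut-L1-t1`, `IsometricPreStepsPullback.lean`).
[cite: MochizukiFrdI2008, Def. 1.3 (i)(c) p.24] -/
theorem exists_isPullbackMorphism_over' (hF : PreFrobenioid.IsFrobenioid F) (B : C) {X₀ : D}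
    (f : X₀ ⟶ PreFrobenioid.baseObj F B) :
    ∃ (W : C) (ψ : W ⟶ B) (i : PreFrobenioid.baseObj F W ≅ X₀),
      PreFrobenioid.IsPullbackMorphism F ψ ∧ PreFrobenioid.Base F ψ = i.hom ≫ f := by
  haveI := hF.i_c B
  obtain ⟨P, ⟨e⟩⟩ := Functor.EssSurj.mem_essImage (PreFrobenioid.pullbackSliceToBase F B) (Over.mk f)
  exact ⟨P.left.obj, P.hom.1, (Over.forget _).mapIso e, P.hom.2, (Over.w e.hom).symm⟩

/-- In a Frobenioid all of whose divisor monoids are trivial ("`Φ = 0`") every arrow is an isometry.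
[cite: MochizukiFrdI2008, Prop. 3.11 p.73] -/
theorem isIsometry_of_zero (hzero : ∀ (X : D) (x : Φ.obj (op X)), x = 1) {A B : C} (φ : A ⟶ B) :
    PreFrobenioid.IsIsometry F φ :=
  hzero _ _

/-- **Prop. 3.11 (i), fullness on `(Base, deg_Fr)`**: in a Frobenioid of isotropic type with `Φ = 0`,
every pair `(f : Base A → Base B, n)` is realised by an arrow `A → B` — a Frobenius-type arrow of degree
`n` (Def. 1.3 (ii)), an isomorphism correcting the base (Def. 1.3 (i)(b): pre-steps out of isotropic
objects are isometric, hence invertible) and a pull-back morphism over `f` (Def. 1.3 (i)(c)).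
[cite: MochizukiFrdI2008, Prop. 3.11 (i) p.73] -/
theorem exists_hom_of_base_degFr (hF : PreFrobenioid.IsFrobenioid F)
    (hzero : ∀ (X : D) (x : Φ.obj (op X)), x = 1) (hiso : ∀ A : C, PreFrobenioid.IsIsotropic F A)
    (A B : C) (f : PreFrobenioid.baseObj F A ⟶ PreFrobenioid.baseObj F B) (n : ℕ+) :
    ∃ φ : A ⟶ B, PreFrobenioid.Base F φ = f ∧ PreFrobenioid.degFr F φ = n := by
  obtain ⟨A', γ, hγ, hγn⟩ := hF.ii_exists A n
  haveI : IsIso (PreFrobenioid.Base F γ) := hγ.2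
  obtain ⟨W, ψ, i, hψ, hψb⟩ :=
    exists_isPullbackMorphism_over' hF B (inv (PreFrobenioid.Base F γ) ≫ f)
  obtain ⟨X, φ₁, ψ₁, hφ₁, hψ₁, hb⟩ := hF.i_b A' W i.symm
  haveI : IsIso φ₁ := hiso X φ₁ (isIsometry_of_zero hzero φ₁) hφ₁
  have hψ' := hF.iv_b ψ hψ
  refine ⟨γ ≫ (inv φ₁ ≫ ψ₁) ≫ ψ, ?_, ?_⟩
  · rw [PreFrobenioid.base_comp, PreFrobenioid.base_comp, PreFrobenioid.base_comp, hψb]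
    have e : PreFrobenioid.Base F (inv φ₁) ≫ PreFrobenioid.Base F ψ₁ = i.inv := by
      rw [← hb, ← Category.assoc, ← PreFrobenioid.base_comp, IsIso.inv_hom_id,
        PreFrobenioid.base_id, Category.id_comp]
      rfl
    rw [e, Iso.inv_hom_id_assoc, IsIso.hom_inv_id_assoc]
  · rw [PreFrobenioid.degFr_comp, PreFrobenioid.degFr_comp, PreFrobenioid.degFr_comp, hγn,
      show PreFrobenioid.degFr F ψ = 1 from hψ'.2, show PreFrobenioid.degFr F ψ₁ = 1 from hψ₁.1,
      show PreFrobenioid.degFr F (inv φ₁) = 1 from PreFrobenioid.isLinear_of_isIso F (inv φ₁),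
      mul_one, mul_one, mul_one]

end OneFrobenioid

/-! ### The named fact, discharged -/

/-- **[FrdI] Proposition 3.3 (ii) — DISCHARGED**: two co-objective morphisms of `C^istr` are
unit-equivalent iff they have the same Frobenius degree, zero divisor and base projection (kurims
p. 59, proof p. 61). [cite: MochizukiFrdI2008, Prop. 3.3 (ii) p.59] -/
theorem Prop33ii_holds : Prop33ii.{w, v, v', u, u'} := by
  intro D _ Φ C _ F hF A B α₁ α₂
  constructor
  · rintro ⟨X, γ, β, δ, hδ, rfl, rfl⟩
    simp only [ObjectProperty.FullSubcategory.comp_hom, ObjectProperty.homMk_hom]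
    exact invariants_eq_of_unit hF.isPreFrobenioid γ.hom β.hom δ hδ
  · rintro ⟨hdeg, hdiv, hbase⟩
    have hA : PreFrobenioid.IsIsotropic F A.obj :=
      (PreFrobenioidData.ofFunctor_isIsotropic F A.obj).1 A.property
    obtain ⟨Y, γ, δ, u, hu, h₁, h₂⟩ :=
      exists_unit_of_invariants_eq hF hA α₁.hom α₂.hom hdeg hdiv hbase
    have hY : (PreFrobenioidData.ofFunctor Φ F).IsIsotropic Y :=
      (PreFrobenioidData.ofFunctor_isIsotropic F Y).2 (hF.vii_b γ hA)
    refine ⟨⟨Y, hY⟩, ObjectProperty.homMk γ, ObjectProperty.homMk δ, u, hu, ?_, ?_⟩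
    · ext
      exact h₁
    · ext
      exact h₂


/-- **[FrdI] Proposition 3.11 (i) — DISCHARGED** in the unfolded form typed by the statement file: for a
Frobenioid of isotropic, unit-trivial and group-like type over `Φ = 0` (and `D` of FSMFF-type), an arrow
is determined by `(Base, deg_Fr)`, every pair `(f, n)` is realised, and every object of `D` is
isomorphic to some `Base(A)` — i.e. `C → F_Φ` is an equivalence (kurims p. 73).
[cite: MochizukiFrdI2008, Prop. 3.11 (i) p.73] -/
theorem Prop311i_holds : Prop311i.{w, v, v', u, u'} := by
  intro D _ Φ C _ F hF hset
  have hzero : ∀ (X : D) (x : Φ.obj (op X)), x = 1 := hset.zero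
  have hiso : ∀ A : C, PreFrobenioid.IsIsotropic F A := fun A =>
    (PreFrobenioidData.ofFunctor_isIsotropic F A).1 (hset.isotropic.obj A)
  refine ⟨fun A B φ ψ hb hd => ?_, fun A B f n => exists_hom_of_base_degFr hF hzero hiso A B f n,
    fun X => ?_⟩
  · obtain ⟨Y, γ, δ, u, hu, h₁, h₂⟩ := exists_unit_of_invariants_eq hF (hiso A) φ ψ hd
      ((hzero _ _).trans (hzero _ _).symm) hb
    have hu1 : u = 1 := by
      have h := hset.unitTrivial.obj Y
      change PreFrobenioid.unitsSubgroup F Y = ⊥ at h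
      rw [h] at hu
      exact hu
    rw [h₁, h₂, hu1]
    change γ ≫ δ = γ ≫ 𝟙 Y ≫ δ
    rw [Category.id_comp]
  · obtain ⟨A, -, ⟨i⟩⟩ := hF.i_a X
    exact ⟨A, ⟨i⟩⟩

end FrdI

end Literature.AlgebraicGeometry.Frobenioids
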